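import Summits.QuantumFields.YangMills.Theorems.LuscherReductionTwistedTraceScalingBOKernel
import Summits.QuantumFields.YangMills.Theorems.LuscherReductionTwistedTraceScalingBOAssemblyPrelim
import HarnessLib

/-!
# THE (B-OD) DOOR: the off-diagonal Born–Oppenheimer brick from a COEFFICIENT-FREE pointwise quasimode bound on the fibre-transferred profile
# (lane A of S-BASE, crux `TwistedTraceScaling` stmt-QuantumFields-20203, C4-CORE, the (OD) pen; design note `pub/ym-fleet/ym-luscher-20007-p1/COARSE-DESIGN.md` §26.7)

For a BO function `boFun φ Ω` and a test function `g` supported in the tube and fibrewise `w`-orthogonal to `Ω` (`∀ u', fibreInner L w Ω g u' = 0`), the bilinear tube form is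
`X = tubeCross β g (boFun φ Ω) = ∫_{u'}∫_{v'} g(oT u' v')·(∫_u φ(u)·Φ(oT u' v', u) du) dπ(v') du'` with the FIBRE-TRANSFERRED PROFILE `Φ(U, u) = ∫_v K̃_β(U, orthoTube u v)·Ω(v̂) dπ(v)`
(`transferApply_boFun_eq` + the disintegration `integral_boFun_mul_eq`).  If `Φ(orthoTube u' v', u)` is, pointwise, `k(u',u)·Ω(v̂')·w(orthoTube u' v')` up to the RELATIVE error `η`
— for ANY nonnegative slow kernel `k` (the coefficient is free: orthogonality kills the main term) — then
★★★ `tubeCross_boFun_le_of_quasimode`: `|X| ≤ η·∫_{u'} (∫_u |φ(u)| k(u',u) du)·(∫_{v'} |g(oT u' v')|·Ω(v̂')w(oT u' v') dπ(v')) du'`.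
No Fubini beyond the two tree disintegrations; no Gaussian is evaluated (in the frozen model `Ω·w ∝` the Mehler ground state makes the hypothesis an identity with `η = 0`,
`…BTGaussianProfile.stiff_groundState_stiffGaussExp`; positivity of the true kernel against the model gives `η = e^{η₀} − 1` on the core, §26.7).
HONEST FRAMING: a reduction only; the quasimode bound, the tail and the Cauchy–Schwarz packaging into `hOD` are OPEN; C4-CORE OPEN; stub of a child of the CONDITIONAL route R2b1;
not infinite volume, not a gap, not Clay.
-/

set_option autoImplicit false

noncomputable section

open MeasureTheory Filter Topology Real
open scoped BigOperators
open Literature.MathematicalPhysics.QuantumFieldTheory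
open Literature.MathematicalPhysics.QuantumLattice

namespace Summit.QuantumFields.YangMills.Theorems.FemtoTransferGap.TwoLattice.ConstTube

open Summit.QuantumFields.YangMills.Theorems.FemtoTransferGap
open Summit.QuantumFields.YangMills.Theorems.FemtoTransferGap.TwoLattice
open Summit.QuantumFields.YangMills.Theorems.FemtoTransferGap.TwoLattice.Avg
open Summit.QuantumFields.YangMills.Theorems.FemtoTransferGap.TwoLattice.Stiff (LinkSpace)

variable {L : ℕ} [NeZero L]

/-! ## §1 Small facts -/

/-- The indicator BO function `boFun 1 1` is `1` on the tube. [folklore] -/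
theorem boFun_one_one_of_mem {U : GaugeConfig 3 L SU2} (hU : U ∈ orthoTubeSet L) : boFun L (fun _ => (1 : ℝ)) (fun _ => (1 : ℝ)) U = 1 := by
  unfold boFun; rw [Set.indicator_of_mem hU]; ring

/-- A function supported in the tube equals itself times the tube indicator `boFun 1 1`. [folklore] -/
theorem mul_boFun_one_one_of_support {g : GaugeConfig 3 L SU2 → ℝ} (hgt : ∀ U, g U ≠ 0 → U ∈ orthoTubeSet L) (F : GaugeConfig 3 L SU2 → ℝ) (U : GaugeConfig 3 L SU2) :
    g U * F U = boFun L (fun _ => (1 : ℝ)) (fun _ => (1 : ℝ)) U * F U * g U := by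
  by_cases hg : g U = 0
  · rw [hg]; ring
  · rw [boFun_one_one_of_mem (hgt U hg)]; ring

/-- The fibre-transferred profile `u ↦ Φ(U,u) = ∫_v K̃(U, orthoTube u v) Ω(v̂) dπ(v)` is measurable in `u` and bounded. [folklore] -/
theorem transferredProfile_props (β : ℝ) {Ω : LinkSpace L → ℝ} (hΩm : Measurable Ω) {CΩ : ℝ} (hCΩ : ∀ x, |Ω x| ≤ CΩ) (U : GaugeConfig 3 L SU2) :
    (Measurable fun u : GaugeConfig 3 1 SU2 => ∫ v, avgKernel β U (orthoTube L u v) * Ω (linkEmbed L v) ∂orthoTransverse L) ∧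
      ∃ M : ℝ, ∀ u : GaugeConfig 3 1 SU2, |∫ v, avgKernel β U (orthoTube L u v) * Ω (linkEmbed L v) ∂orthoTransverse L| ≤ M := by
  haveI := isFiniteMeasure_orthoTransverse L
  obtain ⟨M, hM0, hM⟩ := exists_avgKernel_le (L := L) β
  have hCΩ0 : 0 ≤ CΩ := (abs_nonneg _).trans (hCΩ 0)
  have hJ : Measurable fun p : GaugeConfig 3 1 SU2 × (Edge 3 L → Fin 3 → ℝ) => avgKernel β U (orthoTube L p.1 p.2) * Ω (linkEmbed L p.2) :=
    (measurable_comp_orthoTube (measurable_avgKernel_right β U)).mul (hΩm.comp ((measurable_linkEmbed L).comp measurable_snd))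
  refine ⟨(hJ.stronglyMeasurable.integral_prod_right' (ν := orthoTransverse L)).measurable, ⟨M * CΩ * (orthoTransverse L).real Set.univ, fun u => ?_⟩⟩
  have hb : ∀ v, |avgKernel β U (orthoTube L u v) * Ω (linkEmbed L v)| ≤ M * CΩ := fun v => by
    rw [abs_mul, abs_of_pos (avgKernel_pos β _ _)]; exact mul_le_mul (hM _ _) (hCΩ _) (abs_nonneg _) hM0.le
  calc |∫ v, avgKernel β U (orthoTube L u v) * Ω (linkEmbed L v) ∂orthoTransverse L| ≤ ∫ v, M * CΩ ∂orthoTransverse L := by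
        refine (abs_integral_le_integral_abs).trans (integral_mono_of_nonneg (ae_of_all _ fun v => abs_nonneg _) (integrable_const _) (ae_of_all _ hb))
    _ = M * CΩ * (orthoTransverse L).real Set.univ := by rw [integral_const, smul_eq_mul, Measure.real]; ring

/-! ## §2 ★★★ The door -/

/-- ★★★ **THE (B-OD) DOOR.**  If the fibre-transferred profile is a RELATIVE `η`-quasimode — `|Φ(oT u' v', u) − k(u',u)·Ω(v̂')·w(oT u' v')| ≤ η·k(u',u)·Ω(v̂')·w(oT u' v')` for all
`u ∈ supp φ`, `u'`, `v'`, ANY measurable bounded `k ≥ 0` — and `g` (supported in the tube) is fibrewise `w`-orthogonal to `Ω`, then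
`|tubeCross β g (boFun φ Ω)| ≤ η·∫_{u'} (∫_u |φ(u)| k(u',u) du)·(∫_{v'} |g(oT u' v')|·Ω(v̂')·w(oT u' v') dπ(v')) du'`. [cite: Luscher1983, §3] [cite: SjostrandZworski2007, §2] -/
theorem tubeCross_boFun_le_of_quasimode (β : ℝ) {Ω : LinkSpace L → ℝ} (hΩm : Measurable Ω) {CΩ : ℝ} (hCΩ : ∀ x, |Ω x| ≤ CΩ) (hΩ0 : ∀ x, 0 ≤ Ω x)
    {w : GaugeConfig 3 L SU2 → ℝ} (hwm : Measurable w) {Cw : ℝ} (hCw : ∀ U, |w U| ≤ Cw) (hw0 : ∀ U, 0 ≤ w U)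
    {φ : GaugeConfig 3 1 SU2 → ℝ} (hφm : Measurable φ) {Cφ : ℝ} (hCφ : ∀ u, |φ u| ≤ Cφ)
    {g : GaugeConfig 3 L SU2 → ℝ} (hgm : Measurable g) {Cg : ℝ} (hCg : ∀ U, |g U| ≤ Cg) (hgt : ∀ U, g U ≠ 0 → U ∈ orthoTubeSet L)
    (horth : ∀ u', fibreInner L w Ω g u' = 0)
    {k : GaugeConfig 3 1 SU2 → GaugeConfig 3 1 SU2 → ℝ} (hkm : Measurable (Function.uncurry k)) {Ck : ℝ} (hCk : ∀ u' u, |k u' u| ≤ Ck) (hk0 : ∀ u' u, 0 ≤ k u' u)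
    {η : ℝ} (hη : 0 ≤ η)
    (hQ : ∀ u, φ u ≠ 0 → ∀ (u' : GaugeConfig 3 1 SU2) (v' : Edge 3 L → Fin 3 → ℝ),
      |(∫ v, avgKernel β (orthoTube L u' v') (orthoTube L u v) * Ω (linkEmbed L v) ∂orthoTransverse L) - k u' u * (Ω (linkEmbed L v') * w (orthoTube L u' v'))| ≤
        η * (k u' u * (Ω (linkEmbed L v') * w (orthoTube L u' v')))) :
    |tubeCross β g (boFun L φ Ω)| ≤
      η * ∫ u', (∫ u, |φ u| * k u' u ∂configMeasure SU2 1) *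
        (∫ v', |g (orthoTube L u' v')| * (Ω (linkEmbed L v') * w (orthoTube L u' v')) ∂orthoTransverse L) ∂configMeasure SU2 1 := by
  haveI := isFiniteMeasure_orthoTransverse L
  have hCφ0 : 0 ≤ Cφ := (abs_nonneg _).trans (hCφ 1)
  have hCΩ0 : 0 ≤ CΩ := (abs_nonneg _).trans (hCΩ 0)
  have hCg0 : 0 ≤ Cg := (abs_nonneg _).trans (hCg 1)
  have hCw0 : 0 ≤ Cw := (abs_nonneg _).trans (hCw 1)
  have hCk0 : 0 ≤ Ck := (abs_nonneg _).trans (hCk 1 1)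
  set P : ℝ := (orthoTransverse L).real Set.univ with hPdef
  have hP0 : 0 ≤ P := measureReal_nonneg
  -- the transfer `F = K̃(boFun φ Ω)`: measurable and bounded
  set F : GaugeConfig 3 L SU2 → ℝ := fun U => ∫ V, avgKernel β U V * boFun L φ Ω V ∂configMeasure SU2 L with hFdef
  obtain ⟨hFm, ⟨MF, hFb⟩, -⟩ := integral_avgKernel_mul_props β (measurable_boFun L hφm hΩm) (abs_boFun_le L hCφ hCΩ)
  -- Step 1: `X = ∫_{u'} fibreInner_g(1, F)(u') du'`
  have hX : tubeCross β g (boFun L φ Ω) = ∫ u', fibreInner L g (fun _ => (1 : ℝ)) F u' ∂configMeasure SU2 1 := by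
    rw [tubeCross_eq_integral_mul]
    have e1 : (fun U => g U * ∫ V, avgKernel β U V * boFun L φ Ω V ∂configMeasure SU2 L) =
        fun U => boFun L (fun _ => (1 : ℝ)) (fun _ => (1 : ℝ)) U * F U * g U := by
      funext U; exact mul_boFun_one_one_of_support hgt F U
    rw [e1, integral_boFun_mul_eq (φ := fun _ => (1 : ℝ)) measurable_const (Cφ := 1) (fun _ => by rw [abs_one]) (Ω := fun _ => (1 : ℝ)) measurable_const (CΩ := 1)
      (fun _ => by rw [abs_one]) hFm hFb hgm hCg]
    refine integral_congr_ae (ae_of_all _ fun u' => ?_)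
    dsimp only; rw [one_mul]
  -- Step 2: on each fibre, `F(oT u' v') = Ω(v̂')w(oT u' v')·A(u') + ∫_u φ R`, and the first term pairs to zero with `g`
  -- the slow factor `A'(u') = ∫_u |φ| k(u',u)` and the fibre factor `B(u') = ∫_{v'} |g| Ω w`
  set A' : GaugeConfig 3 1 SU2 → ℝ := fun u' => ∫ u, |φ u| * k u' u ∂configMeasure SU2 1 with hA'def
  set B : GaugeConfig 3 1 SU2 → ℝ := fun u' => ∫ v', |g (orthoTube L u' v')| * (Ω (linkEmbed L v') * w (orthoTube L u' v')) ∂orthoTransverse L with hBdef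
  have hk_meas : ∀ u', Measurable fun u => k u' u := fun u' => hkm.comp (measurable_const.prodMk measurable_id)
  have hA'0 : ∀ u', 0 ≤ A' u' := fun u' => integral_nonneg fun u => mul_nonneg (abs_nonneg _) (hk0 _ _)
  -- the fibre estimate
  have hfibre : ∀ u', |fibreInner L g (fun _ => (1 : ℝ)) F u'| ≤ η * (A' u' * B u') := by
    intro u'
    -- pointwise in `v'`: `|F(oT u' v') - Ω w A(u')·| ≤ η A'(u') Ω w`, where `A(u') = ∫ φ k`
    set A : ℝ := ∫ u, φ u * k u' u ∂configMeasure SU2 1 with hAdef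
    have hFpt : ∀ v', |F (orthoTube L u' v') - Ω (linkEmbed L v') * w (orthoTube L u' v') * A| ≤
        η * A' u' * (Ω (linkEmbed L v') * w (orthoTube L u' v')) := by
      intro v'
      set U := orthoTube L u' v' with hUdef
      obtain ⟨hΦm, MΦ, hΦb⟩ := transferredProfile_props β hΩm hCΩ U
      have hFU : F U = ∫ u, φ u * (∫ v, avgKernel β U (orthoTube L u v) * Ω (linkEmbed L v) ∂orthoTransverse L) ∂configMeasure SU2 1 := by
        rw [hFdef]; exact transferApply_boFun_eq β hφm hCφ hΩm hCΩ U
      set c : ℝ := Ω (linkEmbed L v') * w U with hcdef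
      have hc0 : 0 ≤ c := mul_nonneg (hΩ0 _) (hw0 _)
      -- integrability of the two pieces
      have hI1 : Integrable (fun u => φ u * (∫ v, avgKernel β U (orthoTube L u v) * Ω (linkEmbed L v) ∂orthoTransverse L)) (configMeasure SU2 1) :=
        integrable_of_measurable_abs_le _ (hφm.mul hΦm) (C := Cφ * MΦ) fun u => by
          rw [abs_mul]; exact mul_le_mul (hCφ u) (hΦb u) (abs_nonneg _) hCφ0
      have hI2 : Integrable (fun u => φ u * (k u' u * c)) (configMeasure SU2 1) :=
        integrable_of_measurable_abs_le _ (hφm.mul ((hk_meas u').mul measurable_const)) (C := Cφ * (Ck * |c|)) fun u => by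
          rw [abs_mul, abs_mul]; exact mul_le_mul (hCφ u) (mul_le_mul_of_nonneg_right (hCk _ _) (abs_nonneg _)) (by positivity) hCφ0
      have hsplit : F U - c * A = ∫ u, (φ u * (∫ v, avgKernel β U (orthoTube L u v) * Ω (linkEmbed L v) ∂orthoTransverse L) - φ u * (k u' u * c)) ∂configMeasure SU2 1 := by
        rw [integral_sub hI1 hI2, ← hFU, hAdef]
        congr 1
        rw [← integral_const_mul]
        exact integral_congr_ae (ae_of_all _ fun u => by ring)
      have hpt : ∀ u, |φ u * (∫ v, avgKernel β U (orthoTube L u v) * Ω (linkEmbed L v) ∂orthoTransverse L) - φ u * (k u' u * c)| ≤ |φ u| * k u' u * (η * c) := by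
        intro u
        by_cases hφ : φ u = 0
        · rw [hφ]; simp
        · rw [← mul_sub, abs_mul, mul_assoc]
          refine mul_le_mul_of_nonneg_left ?_ (abs_nonneg _)
          have h := hQ u hφ u' v'
          rw [← hUdef, ← hcdef] at h
          calc _ ≤ η * (k u' u * c) := h
            _ = k u' u * (η * c) := by ring
      have hI3 : Integrable (fun u => |φ u| * k u' u * (η * c)) (configMeasure SU2 1) :=
        integrable_of_measurable_abs_le _ ((hφm.abs.mul (hk_meas u')).mul measurable_const) (C := Cφ * Ck * (η * |c|)) fun u => by
          rw [abs_mul, abs_mul, abs_abs, abs_of_nonneg (hk0 u' u)]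
          exact mul_le_mul (mul_le_mul (hCφ u) (le_trans (le_abs_self _) (hCk _ _)) (hk0 _ _) hCφ0) (by rw [abs_mul, abs_of_nonneg hη]) (abs_nonneg _) (by positivity)
      calc |F U - Ω (linkEmbed L v') * w U * A| = |F U - c * A| := by rw [hcdef]
        _ ≤ ∫ u, |φ u| * k u' u * (η * c) ∂configMeasure SU2 1 := by
            rw [hsplit]
            exact (abs_integral_le_integral_abs).trans (integral_mono_of_nonneg (ae_of_all _ fun u => abs_nonneg _) hI3 (ae_of_all _ hpt))
        _ = η * A' u' * c := by rw [integral_mul_const, hA'def]; ring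
    -- integrate over the fibre against `g`, using orthogonality
    have hgI : ∀ {h : (Edge 3 L → Fin 3 → ℝ) → ℝ}, Measurable h → (∃ C, ∀ v', |h v'| ≤ C) → Integrable h (orthoTransverse L) := fun hm ⟨C, hC⟩ =>
      integrable_of_measurable_abs_le _ hm hC
    have hmF : Measurable fun v' => F (orthoTube L u' v') * (1 : ℝ) * g (orthoTube L u' v') :=
      ((hFm.comp (measurable_orthoTube_right u')).mul measurable_const).mul (hgm.comp (measurable_orthoTube_right u'))
    have hmM : Measurable fun v' => Ω (linkEmbed L v') * w (orthoTube L u' v') * A * g (orthoTube L u' v') :=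
      (((hΩm.comp (measurable_linkEmbed L)).mul (hwm.comp (measurable_orthoTube_right u'))).mul measurable_const).mul (hgm.comp (measurable_orthoTube_right u'))
    have hIF : Integrable (fun v' => F (orthoTube L u' v') * (1 : ℝ) * g (orthoTube L u' v')) (orthoTransverse L) :=
      hgI hmF ⟨MF * 1 * Cg, fun v' => by
        have hMF0 : 0 ≤ MF := (abs_nonneg _).trans (hFb (orthoTube L u' v'))
        rw [abs_mul, abs_mul, abs_one]; exact mul_le_mul (mul_le_mul_of_nonneg_right (hFb _) zero_le_one) (hCg _) (abs_nonneg _) (by positivity)⟩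
    have hA_abs : |A| ≤ Cφ * Ck := by
      have hI : Integrable (fun u => φ u * k u' u) (configMeasure SU2 1) :=
        integrable_of_measurable_abs_le _ (hφm.mul (hk_meas u')) (C := Cφ * Ck) fun u => by rw [abs_mul]; exact mul_le_mul (hCφ u) (hCk _ _) (abs_nonneg _) hCφ0
      calc |A| ≤ ∫ u, Cφ * Ck ∂configMeasure SU2 1 := by
            rw [hAdef]
            refine (abs_integral_le_integral_abs).trans (integral_mono_of_nonneg (ae_of_all _ fun u => abs_nonneg _) (integrable_const _) (ae_of_all _ fun u => ?_))
            dsimp only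
            rw [abs_mul]; exact mul_le_mul (hCφ u) (hCk _ _) (abs_nonneg _) hCφ0
        _ = Cφ * Ck := by rw [integral_const, smul_eq_mul, probReal_univ, one_mul]
    have hIM : Integrable (fun v' => Ω (linkEmbed L v') * w (orthoTube L u' v') * A * g (orthoTube L u' v')) (orthoTransverse L) :=
      hgI hmM ⟨CΩ * Cw * (Cφ * Ck) * Cg, fun v' => by
        rw [abs_mul, abs_mul, abs_mul]
        exact mul_le_mul (mul_le_mul (mul_le_mul (hCΩ _) (hCw _) (abs_nonneg _) hCΩ0) hA_abs (abs_nonneg _) (by positivity)) (hCg _) (abs_nonneg _) (by positivity)⟩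
    -- the main term vanishes
    have hmain : ∫ v', Ω (linkEmbed L v') * w (orthoTube L u' v') * A * g (orthoTube L u' v') ∂orthoTransverse L = 0 := by
      have e : (fun v' => Ω (linkEmbed L v') * w (orthoTube L u' v') * A * g (orthoTube L u' v')) =
          fun v' => A * (g (orthoTube L u' v') * Ω (linkEmbed L v') * w (orthoTube L u' v')) := by funext v'; ring
      rw [e, integral_const_mul]
      have h0 := horth u'
      unfold fibreInner at h0
      rw [h0, mul_zero]
    -- the remainder
    have hrem_pt : ∀ v', |F (orthoTube L u' v') * 1 * g (orthoTube L u' v') - Ω (linkEmbed L v') * w (orthoTube L u' v') * A * g (orthoTube L u' v')| ≤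
        η * A' u' * (|g (orthoTube L u' v')| * (Ω (linkEmbed L v') * w (orthoTube L u' v'))) := by
      intro v'
      rw [mul_one, ← sub_mul, abs_mul]
      have h := mul_le_mul_of_nonneg_right (hFpt v') (abs_nonneg (g (orthoTube L u' v')))
      calc _ ≤ η * A' u' * (Ω (linkEmbed L v') * w (orthoTube L u' v')) * |g (orthoTube L u' v')| := h
        _ = _ := by ring
    have hIrem : Integrable (fun v' => η * A' u' * (|g (orthoTube L u' v')| * (Ω (linkEmbed L v') * w (orthoTube L u' v')))) (orthoTransverse L) := by
      refine hgI (measurable_const.mul (((hgm.comp (measurable_orthoTube_right u')).abs).mul ((hΩm.comp (measurable_linkEmbed L)).mul (hwm.comp (measurable_orthoTube_right u')))))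
        ⟨|η * A' u'| * (Cg * (CΩ * Cw)), fun v' => ?_⟩
      rw [abs_mul, abs_mul, abs_mul, abs_abs, abs_mul]
      exact mul_le_mul_of_nonneg_left (mul_le_mul (hCg _) (mul_le_mul (hCΩ _) (hCw _) (abs_nonneg _) hCΩ0) (by positivity) hCg0) (by positivity)
    unfold fibreInner
    calc |∫ v', F (orthoTube L u' v') * 1 * g (orthoTube L u' v') ∂orthoTransverse L|
        = |∫ v', (F (orthoTube L u' v') * 1 * g (orthoTube L u' v') - Ω (linkEmbed L v') * w (orthoTube L u' v') * A * g (orthoTube L u' v')) ∂orthoTransverse L| := by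
          rw [integral_sub hIF hIM, hmain, sub_zero]
      _ ≤ ∫ v', η * A' u' * (|g (orthoTube L u' v')| * (Ω (linkEmbed L v') * w (orthoTube L u' v'))) ∂orthoTransverse L :=
          (abs_integral_le_integral_abs).trans (integral_mono_of_nonneg (ae_of_all _ fun v' => abs_nonneg _) hIrem (ae_of_all _ hrem_pt))
      _ = η * (A' u' * B u') := by rw [integral_const_mul, hBdef]; ring
  -- Step 3: integrate the fibre estimate over `u'`
  have hA'm : Measurable A' := by
    have hJ : Measurable fun p : GaugeConfig 3 1 SU2 × GaugeConfig 3 1 SU2 => |φ p.2| * k p.1 p.2 := (hφm.abs.comp measurable_snd).mul hkm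
    exact (hJ.stronglyMeasurable.integral_prod_right' (ν := configMeasure SU2 1)).measurable
  have hA'b : ∀ u', |A' u'| ≤ Cφ * Ck := fun u' => by
    rw [abs_of_nonneg (hA'0 u')]
    calc A' u' ≤ ∫ u, Cφ * Ck ∂configMeasure SU2 1 :=
          integral_mono_of_nonneg (ae_of_all _ fun u => mul_nonneg (abs_nonneg _) (hk0 _ _)) (integrable_const _)
            (ae_of_all _ fun u => mul_le_mul (hCφ u) ((le_abs_self _).trans (hCk _ _)) (hk0 _ _) hCφ0)
      _ = Cφ * Ck := by rw [integral_const, smul_eq_mul, probReal_univ, one_mul]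
  have hBm : Measurable B := by
    have hJ : Measurable fun p : GaugeConfig 3 1 SU2 × (Edge 3 L → Fin 3 → ℝ) => |g (orthoTube L p.1 p.2)| * (Ω (linkEmbed L p.2) * w (orthoTube L p.1 p.2)) :=
      (measurable_comp_orthoTube hgm).abs.mul ((hΩm.comp ((measurable_linkEmbed L).comp measurable_snd)).mul (measurable_comp_orthoTube hwm))
    exact (hJ.stronglyMeasurable.integral_prod_right' (ν := orthoTransverse L)).measurable
  have hB0 : ∀ u', 0 ≤ B u' := fun u' => integral_nonneg fun v' => mul_nonneg (abs_nonneg _) (mul_nonneg (hΩ0 _) (hw0 _))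
  have hBb : ∀ u', |B u'| ≤ Cg * (CΩ * Cw) * P := fun u' => by
    rw [abs_of_nonneg (hB0 u')]
    calc B u' ≤ ∫ v', Cg * (CΩ * Cw) ∂orthoTransverse L :=
          integral_mono_of_nonneg (ae_of_all _ fun v' => mul_nonneg (abs_nonneg _) (mul_nonneg (hΩ0 _) (hw0 _))) (integrable_const _)
            (ae_of_all _ fun v' => mul_le_mul (hCg _) (by
              have h1 := hCΩ (linkEmbed L v'); have h2 := hCw (orthoTube L u' v')
              rw [abs_of_nonneg (hΩ0 _)] at h1; rw [abs_of_nonneg (hw0 _)] at h2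
              exact mul_le_mul h1 h2 (hw0 _) hCΩ0) (mul_nonneg (hΩ0 _) (hw0 _)) hCg0)
      _ = Cg * (CΩ * Cw) * P := by rw [integral_const, smul_eq_mul, hPdef, Measure.real]; ring
  have hIbound : Integrable (fun u' => η * (A' u' * B u')) (configMeasure SU2 1) :=
    integrable_of_measurable_abs_le _ (measurable_const.mul (hA'm.mul hBm)) (C := |η| * (Cφ * Ck * (Cg * (CΩ * Cw) * P))) fun u' => by
      rw [abs_mul, abs_mul]; exact mul_le_mul_of_nonneg_left (mul_le_mul (hA'b u') (hBb u') (abs_nonneg _) (by positivity)) (abs_nonneg _)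
  rw [hX]
  calc |∫ u', fibreInner L g (fun _ => (1 : ℝ)) F u' ∂configMeasure SU2 1| ≤ ∫ u', η * (A' u' * B u') ∂configMeasure SU2 1 :=
        (abs_integral_le_integral_abs).trans (integral_mono_of_nonneg (ae_of_all _ fun u' => abs_nonneg _) hIbound (ae_of_all _ hfibre))
    _ = η * ∫ u', A' u' * B u' ∂configMeasure SU2 1 := integral_const_mul _ _

end Summit.QuantumFields.YangMills.Theorems.FemtoTransferGap.TwoLattice.ConstTube

end
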